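import Summits.CriticalPhenomena.PercolationContinuityZ3.Theorems.PercNearOneGluingNoHeavyLowerTailSahiTwoDimCoupling
import Summits.CriticalPhenomena.PercolationContinuityZ3.Theorems.PercNearOneGluingNoHeavyLowerTailSahiCubeThreeAllOrders

/-!
# `NoHeavyLowerTail` (crux stmt-CriticalPhenomena-4575), Sahi programme P1: Sahi's conjecture of EVERY order for EVERY FKG
# weight on a product of two finite chains (the full two-dimensional case of Lieb–Sahi's Conjecture 1.1, discrete form)

Support file (Sahi cell, seat `prim-sahi-p1`, generation 2; `--supports stmt-CriticalPhenomena-4575`); part 2 of 2.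

Lieb–Sahi [LiebSahi2021, Thm. 3.7] prove `E_n(f_1,…,f_n) ≥ 0` for all `n` on the unit square with LEBESGUE measure; the
tree has the discrete form for the uniform grid (`LiebSahiGrid.sahiPositive_uniformGrid`) and for every PRODUCT weight on a
product of two finite chains (`ProductChains.sahiPositive_prodWeight_linearOrder`).  Here: EVERY FKG (log-supermodular)
probability weight on every product `α × β` of two finite chains is Sahi-positive of every order
(`sahiPositive_of_isFKGMeasure_prod`), and so is every FKG weight on a finite distributive lattice that embeds into such a
product (`sahiPositive_of_latticeEmbedding_prod`; by Dilworth–Birkhoff: the FKG posets whose poset of join-irreducibles has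
width `≤ 2`).  New mathematics, not in print.

Proof: log-supermodularity makes the rows stochastically increasing (`SahiTwoDim.cdf_cross_of_mul_le_mul`); after removing
rows of mass zero, the row-quantile coupling of part 1 (`SahiTwoDim.sahiPositive_of_cdf_cross`) exhibits the weight as a
monotone image of a product weight on a product of two chains, which is Sahi-positive of every order, and Sahi positivity
travels along monotone maps (`SahiPositive.of_pushWeight`).
-/

namespace Summit.CriticalPhenomena.PercolationContinuityZ3.Theorems.SahiTwoDim

open Finset Function Literature.Combinatorics.Sahi2008
open scoped BigOperators

noncomputable section

/-! ## Every FKG weight on a product of two finite chains -/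

section FKG

variable {α : Type*} [LinearOrder α] [Fintype α] {b : ℕ}

/-- **FKG weights on `α × Fin (b+1)`** (`α` a finite chain): Sahi-positive of every order.  Rows of mass zero are removed
(restriction to the sub-chain of positive rows, then push-forward along the inclusion). [this work] -/
theorem sahiPositive_of_isFKGMeasure_prod_fin {μ : α × Fin (b + 1) → ℝ} (hμ : IsFKGMeasure μ) (n : ℕ) :
    SahiPositive μ n := by
  classical
  -- positive rows
  have hr0 : ∀ i, 0 ≤ (∑ j, μ (i, j)) := fun i => sum_nonneg fun j _ => hμ.nonneg _
  have hzero : ∀ i j, ¬ 0 < (∑ j, μ (i, j)) → μ (i, j) = 0 := by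
    intro i j hi
    have h1 : μ (i, j) ≤ (∑ j, μ (i, j)) := by
      exact single_le_sum (f := fun j => μ (i, j)) (fun j _ => hμ.nonneg _) (mem_univ j)
    have h2 := hμ.nonneg (i, j)
    have h3 := hr0 i
    push Not at hi
    linarith
  obtain ⟨μ', hμ'⟩ : ∃ μ' : {i : α // 0 < (∑ j, μ (i, j))} × Fin (b + 1) → ℝ, μ' = fun p => μ (p.1.1, p.2) := ⟨_, rfl⟩
  have hrm : ∀ i : {i : α // 0 < (∑ j, μ (i, j))}, (∑ j, μ' (i, j)) = (∑ j, μ (i.1, j)) := fun i => by simp [hμ']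
  have hcdf : ∀ (i : {i : α // 0 < (∑ j, μ (i, j))}) j, (∑ j', if j' ≤ j then μ' (i, j') else 0) = (∑ j', if j' ≤ j then μ (i.1, j') else 0) := fun i j => by simp [hμ']
  have hsum' : ∑ p, μ' p = 1 := by
    rw [← sum_rowMass]
    simp_rw [hrm]
    rw [← Finset.sum_subtype (univ.filter fun i : α => 0 < (∑ j, μ (i, j))) (by simp) (fun i => ∑ j, μ (i, j)),
      Finset.sum_filter_of_ne, sum_rowMass, hμ.sum_eq_one]
    intro i _ hi
    exact lt_of_le_of_ne (hr0 i) (Ne.symm hi)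
  have hne : Nonempty {i : α // 0 < (∑ j, μ (i, j))} := by
    by_contra h
    rw [not_nonempty_iff] at h
    have h0 : ∑ p, μ' p = 0 := by
      rw [Fintype.sum_prod_type]
      exact Fintype.sum_empty _
    rw [hsum'] at h0
    exact one_ne_zero h0
  have hpos : SahiPositive μ' n :=
    sahiPositive_of_cdf_cross μ' (fun p => by rw [hμ']; exact hμ.nonneg _) hsum' (fun i => by rw [hrm]; exact i.2)
      (fun i i' j hii' => by
        rw [hcdf, hcdf, hrm, hrm]
        exact cdf_cross_of_mul_le_mul μ hμ.mul_le_mul (show i.1 ≤ i'.1 from hii') j) n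
  -- push forward along the inclusion of the positive rows
  obtain ⟨ι, hι⟩ : ∃ ι : {i : α // 0 < (∑ j, μ (i, j))} × Fin (b + 1) → α × Fin (b + 1), ι = fun p => (p.1.1, p.2) :=
    ⟨_, rfl⟩
  have hιmono : Monotone ι := fun p p' h => by rw [hι]; exact ⟨h.1, h.2⟩
  have hιinj : Function.Injective ι := by
    intro p p' h
    rw [hι] at h
    simp only [Prod.mk.injEq] at h
    exact Prod.ext (Subtype.ext h.1) h.2
  have hpush : pushWeight μ' ι = μ := by
    funext ⟨i, j⟩
    by_cases hi : 0 < (∑ j, μ (i, j))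
    · have h := pushWeight_apply_of_injective μ' hιinj (⟨i, hi⟩, j)
      rw [hι] at h ⊢
      rw [h, hμ']
    · rw [hzero i j hi]
      refine pushWeight_eq_zero_of_forall_ne μ' fun p hp => ?_
      rw [hι] at hp
      simp only [Prod.mk.injEq] at hp
      exact hi (hp.1 ▸ p.1.2)
  rw [← hpush]
  exact SahiPositive.of_pushWeight hpos hιmono

/-- **Sahi's conjecture, every order, for every FKG weight on a product of two finite chains** (the full two-dimensional
case of [LiebSahi2021, Conj. 1.1] in discrete form; Lieb–Sahi prove the Lebesgue / uniform case, Thm. 3.7): for finite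
linear orders `α, β` and every FKG probability weight `μ` on `α × β` (componentwise order), `E_n(f_1,…,f_n) ≥ 0` for every `n`
and all nonnegative monotone `f_i`. [this work] -/
theorem sahiPositive_of_isFKGMeasure_prod {β : Type*} [LinearOrder β] [Fintype β] {μ : α × β → ℝ}
    (hμ : IsFKGMeasure μ) (n : ℕ) : SahiPositive μ n := by
  classical
  -- `β` is nonempty (total mass one) and order-isomorphic to `Fin (b+1)`
  have hβ : Nonempty β := by
    by_contra h
    rw [not_nonempty_iff] at h
    have h0 : ∑ p, μ p = 0 := by rw [Fintype.sum_prod_type_right]; exact Fintype.sum_empty _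
    exact one_ne_zero (hμ.sum_eq_one.symm.trans h0)
  obtain ⟨b, hb⟩ : ∃ b, Fintype.card β = b + 1 := Nat.exists_eq_succ_of_ne_zero Fintype.card_ne_zero
  obtain ⟨e, -⟩ : ∃ e : Fin (b + 1) ≃o β, True := ⟨Fintype.orderIsoFinOfCardEq β hb, trivial⟩
  obtain ⟨μ'', hμ''⟩ : ∃ μ'' : α × Fin (b + 1) → ℝ, μ'' = fun p => μ (p.1, e p.2) := ⟨_, rfl⟩
  obtain ⟨E, hE⟩ : ∃ E : α × Fin (b + 1) ≃ α × β, E = (Equiv.refl α).prodCongr e.toEquiv := ⟨_, rfl⟩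
  have hEmono : Monotone E := fun p q h => by rw [hE]; exact ⟨h.1, e.monotone h.2⟩
  have hFKG : IsFKGMeasure μ'' := by
    refine ⟨fun p => by rw [hμ'']; exact hμ.nonneg _, ?_, fun p q => ?_⟩
    · rw [hμ'', ← hμ.sum_eq_one]
      exact E.sum_comp (fun p => μ p) |>.symm ▸ (by rw [hE]; rfl)
    · rw [hμ'']
      have h := hμ.mul_le_mul (p.1, e p.2) (q.1, e q.2)
      have hinf : ((p.1, e p.2) : α × β) ⊓ (q.1, e q.2) = ((p ⊓ q).1, e (p ⊓ q).2) := by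
        ext <;> simp [e.map_inf]
      have hsup : ((p.1, e p.2) : α × β) ⊔ (q.1, e q.2) = ((p ⊔ q).1, e (p ⊔ q).2) := by
        ext <;> simp [e.map_sup]
      rw [hinf, hsup] at h
      exact h
  have hpush : pushWeight μ'' E = μ := by
    funext c
    rw [pushWeight_equiv, hμ'', hE]
    rcases c with ⟨i, j⟩
    simp
  rw [← hpush]
  exact SahiPositive.of_pushWeight (sahiPositive_of_isFKGMeasure_prod_fin hFKG n) hEmono

/-- **Sublattices of two-dimensional grids.**  If a finite distributive lattice `L` admits an injective map into a product
of two finite chains preserving `⊓` and `⊔` (equivalently, by Dilworth–Birkhoff, its poset of join-irreducibles has width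
`≤ 2`), then every FKG probability weight on `L` is Sahi-positive of every order: push the weight forward (it stays FKG,
`isFKGMeasure_pushWeight`), apply `sahiPositive_of_isFKGMeasure_prod`, and descend along the monotone retraction
`p ↦ ⋁{x : e x ≤ p}` (`SahiCubeAllOrders.sahiPositive_of_pushWeight_of_retract`). [this work] -/
theorem sahiPositive_of_latticeEmbedding_prod {L : Type*} [DistribLattice L] [Fintype L] [DecidableEq L]
    {β : Type*} [LinearOrder β] [Fintype β] (e : L → α × β) (he : Function.Injective e)
    (hinf : ∀ x y, e (x ⊓ y) = e x ⊓ e y) (hsup : ∀ x y, e (x ⊔ y) = e x ⊔ e y) {μ : L → ℝ} (hμ : IsFKGMeasure μ)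
    (n : ℕ) : SahiPositive μ n := by
  classical
  have hL : Nonempty L := by
    by_contra h
    rw [not_nonempty_iff] at h
    exact one_ne_zero (hμ.sum_eq_one.symm.trans (Fintype.sum_empty _))
  letI : OrderBot L := Fintype.toOrderBot L
  -- `e` reflects the order
  have hle : ∀ x y, e x ≤ e y ↔ x ≤ y := by
    intro x y
    constructor
    · intro h
      have h1 : e (x ⊓ y) = e x := by rw [hinf]; exact inf_eq_left.2 h
      exact inf_eq_left.1 (he h1)
    · intro h
      have h1 : e x ⊓ e y = e x := by rw [← hinf, inf_eq_left.2 h]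
      exact inf_eq_left.1 h1
  -- the monotone retraction
  obtain ⟨R, hR⟩ : ∃ R : α × β → L, ∀ p, R p = (univ.filter fun x => e x ≤ p).sup id := ⟨_, fun p => rfl⟩
  have hRmono : Monotone R := by
    intro p p' hpp'
    rw [hR, hR]
    refine Finset.sup_mono fun x hx => ?_
    rw [mem_filter] at hx ⊢
    exact ⟨hx.1, hx.2.trans hpp'⟩
  have hRE : ∀ x, R (e x) = x := by
    intro x
    rw [hR]
    refine le_antisymm (Finset.sup_le fun y hy => ?_) ?_
    · rw [mem_filter] at hy
      exact (hle y x).1 hy.2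
    · exact Finset.le_sup (f := id) (by rw [mem_filter]; exact ⟨mem_univ _, le_rfl⟩)
  have hFKG : IsFKGMeasure (pushWeight μ e) := isFKGMeasure_pushWeight hμ he hinf hsup
  exact SahiCubeAllOrders.sahiPositive_of_pushWeight_of_retract hRmono hRE (sahiPositive_of_isFKGMeasure_prod hFKG n)

end FKG

end

end Summit.CriticalPhenomena.PercolationContinuityZ3.Theorems.SahiTwoDim
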